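import Summits.BirchSwinnertonDyer.BirchSwinnertonDyer.Theorems.Rank2ObservatoryTorsionCertB
import HarnessLib

/-!
# Rank-2 observatory — torsion certificates, part C: orders 2 and 4, scaling

HONEST FRAMING: per-curve certified theorems and census instruments; no claim on BSD in rank ≥ 2.

This part: the order theorems `#E(ℚ)_tors = 2` (with exponent `2`), `= 4` cyclic (with an element of
order `4`) and `= 4` split (with exponent `2`) from reduction witnesses, and the transport of
`torsionOrder` and of the structure statements along the scaling isomorphism `V ≅ scaleModel V d`
(`d ≠ 0`), so that certificates may be written on a model where the `2`-torsion is integral.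
-/

-- single-conjunct summit: `Summit.BirchSwinnertonDyer.BirchSwinnertonDyer.…` repeats the name by design
set_option linter.dupNamespace false

namespace Summit.BirchSwinnertonDyer.BirchSwinnertonDyer.Rank2Observatory

open WeierstrassCurve Literature.NumberTheory.EllipticCurves

section Orders

variable (V : WeierstrassCurve ℤ)

/-- **`E(ℚ)_tors ≅ ℤ/2`**: killers with annihilator `t = 2^e`, an integral `2`-torsion point
`T`, and the witnesses of `torsion_zsmul_eq_zero_of_twoTorsionWitness` give `#E(ℚ)_tors = 2` (and
exponent `2`). [cite: SilvermanAEC2009, Prop. VII.3.1(b)] -/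
theorem torsionOrder_eq_two_of_witness {S : List (ℕ × ℕ)} {e : ℕ} (hS : S.all (killerB V) = true)
    (ht : annihilatorCheck S (2 ^ e) = true) {xT yT : ℤ}
    (hT : yT ^ 2 + V.a₁ * xT * yT + V.a₃ * yT = xT ^ 3 + V.a₂ * xT ^ 2 + V.a₄ * xT + V.a₆)
    (hT2 : 2 * yT + V.a₁ * xT + V.a₃ = 0)
    (ℓ₁ : ℕ) [Fact ℓ₁.Prime] (hℓ₁ : ¬ (ℓ₁ : ℤ) ∣ V.Δ) (hodd : ℓ₁ ≠ 2)
    (hB₁ : twoTorsionOnlyB V ℓ₁ xT yT = true)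
    (ℓ₂ : ℕ) [Fact ℓ₂.Prime] (hℓ₂ : ¬ (ℓ₂ : ℤ) ∣ V.Δ)
    (hB₂ : xDoubleFree V ℓ₂ (xT : ZMod ℓ₂) = true) :
    (V.map (Int.castRingHom ℚ)).torsionOrder = 2 ∧
      ∀ τ : (V.map (Int.castRingHom ℚ)).toAffine.Point, IsOfFinAddOrder τ → 2 • τ = 0 := by
  have hΔ : V.Δ ≠ 0 := Δ_ne_zero_of_not_dvd V hℓ₁
  set T : (V.map (Int.castRingHom ℚ)).toAffine.Point :=
    .some (xT : ℚ) (yT : ℚ) (nonsingular_rat_of_eq V hΔ hT) with hTdef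
  have h2 : ∀ τ : (V.map (Int.castRingHom ℚ)).toAffine.Point, IsOfFinAddOrder τ →
      (2 : ℤ) • τ = 0 := fun τ hτ => by
    have h := torsion_zsmul_eq_zero_of_twoTorsionWitness V (show 2 ^ e = 2 ^ e * 1 by ring)
      (killers_of_all_killerB V hS) ht hT hT2 ℓ₁ hℓ₁ hodd hB₁ ℓ₂ hℓ₂ hB₂ τ hτ
    rwa [pow_one, Nat.cast_one, mul_one] at h
  have hT2' : 2 • T = 0 := two_nsmul_some_eq_zero V hΔ hT hT2
  have hTfin : IsOfFinAddOrder T := isOfFinAddOrder_iff_nsmul_eq_zero.mpr ⟨2, by norm_num, hT2'⟩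
  have hT0 : T ≠ 0 := Affine.Point.some_ne_zero _
  refine ⟨?_, fun τ hτ => (two_zsmul_eq_zero_iff τ).mp (h2 τ hτ)⟩
  rw [torsionOrder_eq_card _ {0, T} ?_]
  · exact Finset.card_pair hT0.symm
  · intro τ
    constructor
    · intro hτ
      rcases twoTorsion_eq_zero_or_eq V hT hT2 ℓ₁ hℓ₁ hodd hB₁ τ (h2 τ hτ) with h | h
      · rw [h]; exact Finset.mem_insert_self _ _
      · exact Finset.mem_insert_of_mem (Finset.mem_singleton.mpr h)
    · intro hτ
      rcases Finset.mem_insert.mp hτ with h | h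
      · rw [h]; exact IsOfFinAddOrder.zero
      · rw [Finset.mem_singleton.mp h]; exact hTfin

/-- **`E(ℚ)_tors ≅ ℤ/4`**: killers with annihilator `t = 2^e`, integral `T₄` with `2T₄ = T`,
`2T = 0`, and the witnesses of `torsion_zsmul_eq_zero_of_fourTorsionWitness` give `#E(ℚ)_tors = 4`
with an element of order `4`. [cite: SilvermanAEC2009, Prop. VII.3.1(b)] -/
theorem torsionOrder_eq_four_of_witness {S : List (ℕ × ℕ)} {e : ℕ} (hS : S.all (killerB V) = true)
    (ht : annihilatorCheck S (2 ^ e) = true) {xT yT x₄ y₄ : ℤ}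
    (hT : yT ^ 2 + V.a₁ * xT * yT + V.a₃ * yT = xT ^ 3 + V.a₂ * xT ^ 2 + V.a₄ * xT + V.a₆)
    (hT2 : 2 * yT + V.a₁ * xT + V.a₃ = 0)
    (h₄ : y₄ ^ 2 + V.a₁ * x₄ * y₄ + V.a₃ * y₄ = x₄ ^ 3 + V.a₂ * x₄ ^ 2 + V.a₄ * x₄ + V.a₆)
    (htan : intTangent V x₄ y₄ xT yT = true)
    (ℓ₁ : ℕ) [Fact ℓ₁.Prime] (hℓ₁ : ¬ (ℓ₁ : ℤ) ∣ V.Δ) (hodd : ℓ₁ ≠ 2)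
    (hB₁ : twoTorsionOnlyB V ℓ₁ xT yT = true) (hB₂ : halfTOnlyB V ℓ₁ xT x₄ y₄ = true)
    (ℓ₂ : ℕ) [Fact ℓ₂.Prime] (hℓ₂ : ¬ (ℓ₂ : ℤ) ∣ V.Δ)
    (hB₃ : xDoubleFree V ℓ₂ (x₄ : ZMod ℓ₂) = true) :
    (V.map (Int.castRingHom ℚ)).torsionOrder = 4 ∧
      ∃ τ : (V.map (Int.castRingHom ℚ)).toAffine.Point, IsOfFinAddOrder τ ∧ 2 • τ ≠ 0 := by
  have hΔ : V.Δ ≠ 0 := Δ_ne_zero_of_not_dvd V hℓ₁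
  set T : (V.map (Int.castRingHom ℚ)).toAffine.Point :=
    .some (xT : ℚ) (yT : ℚ) (nonsingular_rat_of_eq V hΔ hT) with hTdef
  set T₄ : (V.map (Int.castRingHom ℚ)).toAffine.Point :=
    .some (x₄ : ℚ) (y₄ : ℚ) (nonsingular_rat_of_eq V hΔ h₄) with hT₄def
  have h4 : ∀ τ : (V.map (Int.castRingHom ℚ)).toAffine.Point, IsOfFinAddOrder τ →
      (2 : ℤ) ^ 2 • τ = 0 := fun τ hτ => by
    have h := torsion_zsmul_eq_zero_of_fourTorsionWitness V (show 2 ^ e = 2 ^ e * 1 by ring)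
      (killers_of_all_killerB V hS) ht hT hT2 h₄ htan ℓ₁ hℓ₁ hodd hB₁ hB₂ ℓ₂ hℓ₂ hB₃ τ hτ
    rwa [Nat.cast_one, mul_one] at h
  have hdbl : T₄ + T₄ = T := some_add_self_of_intTangent V hΔ h₄ hT htan
  have hT2' : 2 • T = 0 := two_nsmul_some_eq_zero V hΔ hT hT2
  have hT0 : T ≠ 0 := Affine.Point.some_ne_zero _
  have hT₄0 : T₄ ≠ 0 := Affine.Point.some_ne_zero _
  have hT₄2 : 2 • T₄ = T := by rw [two_nsmul, hdbl]
  have hT₄4 : 4 • T₄ = 0 := by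
    rw [show (4 : ℕ) = 2 * 2 from rfl, mul_nsmul, hT₄2, hT2']
  have hTfin : IsOfFinAddOrder T := isOfFinAddOrder_iff_nsmul_eq_zero.mpr ⟨2, by norm_num, hT2'⟩
  have hT₄fin : IsOfFinAddOrder T₄ :=
    isOfFinAddOrder_iff_nsmul_eq_zero.mpr ⟨4, by norm_num, hT₄4⟩
  refine ⟨?_, ⟨T₄, hT₄fin, by rw [hT₄2]; exact hT0⟩⟩
  have h01 : (0 : (V.map (Int.castRingHom ℚ)).toAffine.Point) ≠ T₄ := hT₄0.symm
  have h02 : (0 : (V.map (Int.castRingHom ℚ)).toAffine.Point) ≠ T := hT0.symm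
  have h03 : (0 : (V.map (Int.castRingHom ℚ)).toAffine.Point) ≠ -T₄ :=
    fun h => hT₄0 (neg_eq_zero.mp h.symm)
  have h12 : T₄ ≠ T := fun h => hT0 (by rw [← hdbl, h, ← two_nsmul, hT2'])
  have h13 : T₄ ≠ -T₄ := fun h => hT0 (by rw [← hdbl]; exact add_eq_zero_iff_eq_neg.mpr h)
  have h23 : T ≠ -T₄ := by
    intro h
    have h3 : T₄ + T₄ + T₄ = 0 := by rw [hdbl, h, neg_add_cancel]
    have h4' : T₄ + T₄ + (T₄ + T₄) = 0 := by rw [hdbl, ← two_nsmul, hT2']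
    have : T₄ = T₄ + T₄ + (T₄ + T₄) - (T₄ + T₄ + T₄) := by abel
    rw [h3, h4', sub_zero] at this
    exact hT₄0 this
  rw [torsionOrder_eq_card _ {0, T₄, T, -T₄} ?_]
  · exact Finset.card_eq_four.mpr ⟨0, T₄, T, -T₄, h01, h02, h03, h12, h13, h23, rfl⟩
  · intro τ
    constructor
    · intro hτ
      rcases fourTorsion_eq V hT hT2 h₄ htan ℓ₁ hℓ₁ hodd hB₁ hB₂ τ (h4 τ hτ) with h | h | h | h
      · rw [h]; exact Finset.mem_insert_self _ _
      · exact Finset.mem_insert_of_mem (Finset.mem_insert.mpr (Or.inl h))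
      · refine Finset.mem_insert_of_mem (Finset.mem_insert_of_mem (Finset.mem_insert.mpr (Or.inl ?_)))
        rw [h]; exact hdbl
      · exact Finset.mem_insert_of_mem (Finset.mem_insert_of_mem (Finset.mem_insert_of_mem
          (Finset.mem_singleton.mpr h)))
    · intro hτ
      simp only [Finset.mem_insert, Finset.mem_singleton] at hτ
      rcases hτ with h | h | h | h
      · rw [h]; exact IsOfFinAddOrder.zero
      · rw [h]; exact hT₄fin
      · rw [h]; exact hTfin
      · rw [h]; exact hT₄fin.neg

/-- **`E(ℚ)_tors ≅ ℤ/2 × ℤ/2`**: killers with annihilator `t = 2^e`, split `2`-torsion with the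
three double-free witnesses give `#E(ℚ)_tors = 4` and exponent `2`.
[cite: SilvermanAEC2009, Prop. VII.3.1(b)] -/
theorem torsionOrder_eq_four_of_split {S : List (ℕ × ℕ)} {e : ℕ} (hS : S.all (killerB V) = true)
    (ht : annihilatorCheck S (2 ^ e) = true) {x₁ y₁ x₂ y₂ x₃ y₃ : ℤ}
    (h₁ : y₁ ^ 2 + V.a₁ * x₁ * y₁ + V.a₃ * y₁ = x₁ ^ 3 + V.a₂ * x₁ ^ 2 + V.a₄ * x₁ + V.a₆)
    (h₂ : y₂ ^ 2 + V.a₁ * x₂ * y₂ + V.a₃ * y₂ = x₂ ^ 3 + V.a₂ * x₂ ^ 2 + V.a₄ * x₂ + V.a₆)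
    (h₃ : y₃ ^ 2 + V.a₁ * x₃ * y₃ + V.a₃ * y₃ = x₃ ^ 3 + V.a₂ * x₃ ^ 2 + V.a₄ * x₃ + V.a₆)
    (hs : twoSplitB V x₁ y₁ x₂ y₂ x₃ y₃ = true)
    (q₁ : ℕ) [Fact (Nat.Prime q₁)] (hq₁ : ¬ (q₁ : ℤ) ∣ V.Δ)
    (hf₁ : xDoubleFree V q₁ (x₁ : ZMod q₁) = true)
    (q₂ : ℕ) [Fact (Nat.Prime q₂)] (hq₂ : ¬ (q₂ : ℤ) ∣ V.Δ)
    (hf₂ : xDoubleFree V q₂ (x₂ : ZMod q₂) = true)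
    (q₃ : ℕ) [Fact (Nat.Prime q₃)] (hq₃ : ¬ (q₃ : ℤ) ∣ V.Δ)
    (hf₃ : xDoubleFree V q₃ (x₃ : ZMod q₃) = true) :
    (V.map (Int.castRingHom ℚ)).torsionOrder = 4 ∧
      ∀ τ : (V.map (Int.castRingHom ℚ)).toAffine.Point, IsOfFinAddOrder τ → 2 • τ = 0 := by
  have hΔ : V.Δ ≠ 0 := Δ_ne_zero_of_not_dvd V hq₁
  have hs' := hs
  simp only [twoSplitB, decide_eq_true_eq] at hs'
  obtain ⟨hd₁, hd₂, hd₃, -, -, -, hx₁₂, hx₁₃, hx₂₃⟩ := hs'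
  have h2 : ∀ τ : (V.map (Int.castRingHom ℚ)).toAffine.Point, IsOfFinAddOrder τ → 2 • τ = 0 := by
    intro τ hτ
    have hk := nsmul_eq_zero_of_annihilatorCheck (killers_of_all_killerB V hS) ht hτ
    cases e with
    | zero => simp at hk; simp [hk]
    | succ k =>
      exact two_nsmul_eq_zero_of_pow
        (two_nsmul_eq_zero_of_four_nsmul_of_split V h₁ h₂ h₃ hs q₁ hq₁ hf₁ q₂ hq₂ hf₂ q₃ hq₃ hf₃)
        k τ hk
  set T₁ : (V.map (Int.castRingHom ℚ)).toAffine.Point :=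
    .some (x₁ : ℚ) (y₁ : ℚ) (nonsingular_rat_of_eq V hΔ h₁) with hT₁
  set T₂ : (V.map (Int.castRingHom ℚ)).toAffine.Point :=
    .some (x₂ : ℚ) (y₂ : ℚ) (nonsingular_rat_of_eq V hΔ h₂) with hT₂
  set T₃ : (V.map (Int.castRingHom ℚ)).toAffine.Point :=
    .some (x₃ : ℚ) (y₃ : ℚ) (nonsingular_rat_of_eq V hΔ h₃) with hT₃
  have fin_of_two : ∀ {X Y : ℤ}
      (hXY : Y ^ 2 + V.a₁ * X * Y + V.a₃ * Y = X ^ 3 + V.a₂ * X ^ 2 + V.a₄ * X + V.a₆)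
      (hd : 2 * Y + V.a₁ * X + V.a₃ = 0),
      IsOfFinAddOrder (Affine.Point.some (X : ℚ) (Y : ℚ) (nonsingular_rat_of_eq V hΔ hXY) :
        (V.map (Int.castRingHom ℚ)).toAffine.Point) := fun hXY hd =>
    isOfFinAddOrder_iff_nsmul_eq_zero.mpr ⟨2, by norm_num, two_nsmul_some_eq_zero V hΔ hXY hd⟩
  have h01 : (0 : (V.map (Int.castRingHom ℚ)).toAffine.Point) ≠ T₁ :=
    (Affine.Point.some_ne_zero _).symm
  have h02 : (0 : (V.map (Int.castRingHom ℚ)).toAffine.Point) ≠ T₂ :=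
    (Affine.Point.some_ne_zero _).symm
  have h03 : (0 : (V.map (Int.castRingHom ℚ)).toAffine.Point) ≠ T₃ :=
    (Affine.Point.some_ne_zero _).symm
  have h12 : T₁ ≠ T₂ := some_ne_some_of_ne V hx₁₂ _ _
  have h13 : T₁ ≠ T₃ := some_ne_some_of_ne V hx₁₃ _ _
  have h23 : T₂ ≠ T₃ := some_ne_some_of_ne V hx₂₃ _ _
  refine ⟨?_, h2⟩
  rw [torsionOrder_eq_card _ {0, T₁, T₂, T₃} ?_]
  · exact Finset.card_eq_four.mpr ⟨0, T₁, T₂, T₃, h01, h02, h03, h12, h13, h23, rfl⟩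
  · intro τ
    constructor
    · intro hτ
      rcases eq_of_two_nsmul_eq_zero_of_split V hΔ h₁ h₂ h₃ hs τ (h2 τ hτ) with h | h | h | h
      · rw [h]; exact Finset.mem_insert_self _ _
      · exact Finset.mem_insert_of_mem (Finset.mem_insert.mpr (Or.inl h))
      · exact Finset.mem_insert_of_mem (Finset.mem_insert_of_mem (Finset.mem_insert.mpr (Or.inl h)))
      · exact Finset.mem_insert_of_mem (Finset.mem_insert_of_mem (Finset.mem_insert_of_mem
          (Finset.mem_singleton.mpr h)))
    · intro hτ
      simp only [Finset.mem_insert, Finset.mem_singleton] at hτ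
      rcases hτ with h | h | h | h
      · rw [h]; exact IsOfFinAddOrder.zero
      · rw [h]; exact fin_of_two h₁ hd₁
      · rw [h]; exact fin_of_two h₂ hd₂
      · rw [h]; exact fin_of_two h₃ hd₃

/-! #### Scaling -/

/-- **The torsion order of the scaled model is that of `V`** (`map_scaleModel_eq_smul` and
Literature's `torsionOrder_variableChange_holds`). [cite: SilvermanAEC2009, III.3.1(b)] -/
theorem torsionOrder_scaleModel {d : ℤ} (hd : d ≠ 0) :
    ((scaleModel V d).map (Int.castRingHom ℚ)).torsionOrder =
      (V.map (Int.castRingHom ℚ)).torsionOrder := by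
  rw [map_scaleModel_eq_smul V hd]
  exact torsionOrder_variableChange_holds _ _

/-- The group isomorphism `E(ℚ) ≃+ E_d(ℚ)` onto the points of the scaled model
(`(x, y) ↦ (d²x, d³y)`). [cite: SilvermanAEC2009, III.3.1(b)] -/
noncomputable def scalePointEquiv {d : ℤ} (hd : d ≠ 0) :
    (V.map (Int.castRingHom ℚ)).toAffine.Point ≃+
      ((scaleModel V d).map (Int.castRingHom ℚ)).toAffine.Point :=
  (VariableChange.pointEquiv (V.map (Int.castRingHom ℚ)) _).trans
    (Affine.Point.congrEquiv (map_scaleModel_eq_smul V hd).symm)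

/-- Exponent `2` of the torsion subgroup transports along a group isomorphism. [folklore] -/
theorem torsion_two_nsmul_of_addEquiv {A B : Type*} [AddCommGroup A] [AddCommGroup B] (e : A ≃+ B)
    (h : ∀ b : B, IsOfFinAddOrder b → 2 • b = 0) : ∀ a : A, IsOfFinAddOrder a → 2 • a = 0 := by
  intro a ha
  have hb := h (e a) (e.toAddMonoidHom.isOfFinAddOrder ha)
  rw [← map_nsmul] at hb
  exact (EmbeddingLike.map_eq_zero_iff (f := e)).mp hb

/-- A torsion element with `2 • a ≠ 0` transports along a group isomorphism. [folklore] -/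
theorem exists_torsion_two_nsmul_ne_of_addEquiv {A B : Type*} [AddCommGroup A] [AddCommGroup B]
    (e : A ≃+ B) (h : ∃ b : B, IsOfFinAddOrder b ∧ 2 • b ≠ 0) :
    ∃ a : A, IsOfFinAddOrder a ∧ 2 • a ≠ 0 := by
  obtain ⟨b, hb, hb2⟩ := h
  refine ⟨e.symm b, e.symm.toAddMonoidHom.isOfFinAddOrder hb, fun h0 => hb2 ?_⟩
  have := congrArg e h0
  rwa [map_nsmul, AddEquiv.apply_symm_apply, map_zero] at this

end Orders

end Summit.BirchSwinnertonDyer.BirchSwinnertonDyer.Rank2Observatory
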